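import Summits.CriticalPhenomena.PercolationContinuityZ3.Theorems.Transplant.PlanarSkeletonFrmRayHolds
import Summits.CriticalPhenomena.PercolationContinuityZ3.Theorems.Transplant.PlanarSkeletonFrmCylHolds
import Summits.CriticalPhenomena.PercolationContinuityZ3.Theorems.Transplant.CayleySkeletonSign
import HarnessLib

/-!
# TWISTED FRAMES: for the CLOSED nodes, frames may act on the chart by SIGNED translations `y ↦ ε • y + c` (`ε ∈ {±1}²`) —
# one base vertex with `−I` and an axis flip re-straightens them; at the Cayley level the input of the unconditional tier is a homomorphism
# `Γ → D_∞ × D_∞` (a sign-twisted cocycle), NOT `Γ → ℤ × ℤ`: the first Betti number of `Γ` is irrelevant there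

builds on p205010 (kernel theorem, internal audit signed; external expert review pending): the unconditional theorems of this file run through
the CLOSED nodes `samePDropOfSkeletonSign_holds` (D″, via `PlanarSkeletonSign.criticalContinuity_skeleton_only`) and `samePDropOfSkeletonNeg₁_holds`
(N1, via `PlanarSkeletonNeg.criticalContinuity_of_oneType`), whose proofs use near-one gluing (AdditiveGluing), which builds on p205010.  NOTHING is
claimed about the OPEN frames-only nodes `SamePDropOfSkeletonFrm₁` / `…FrmFrom₁` / `…FrmScaled₁`.
Lane `prim-bschramm`, seat `prim-bschramm-p4` (gen 20; PART C3, `HOME/bschramm/P4-GENERAL.md` §42).  Helper file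
(`--supports stmt-CriticalPhenomena-4575 --as helper`).

THE POINT.  Every interface of the lane (`PlanarSkeleton{Conc,Sign,Neg,Frm,FrmFrom,FrmScaled}`) asks the frames to TRANSLATE the chart:
`φ ∘ α = φ + c`.  For the frames-only OPEN nodes this is load-bearing (one type, one law, one preferred quadrant — ruling (R-6)).  For the CLOSED
nodes it is not: if every vertex `v` is the image of ONE base vertex `t₀` under an automorphism acting on the chart by a SIGNED translation
`φ(α w) − φ v = ε • (φ w − φ t₀)`, `ε ∈ {±1}²` (the axis Klein four-group: `I`, `−I`, `diag(1,−1) = flipSnd`, `diag(−1,1) = flipFst`), and `t₀` carries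
the central inversion and the axis flip, then composing each twisted frame with the matching point symmetry at `t₀` gives a TRANSLATING frame:
the carrier is a ONE-type `PlanarSkeletonSign` (`TwistedSign.toSign`), hence **`TwistedSign.criticalContinuity : θ_v(p_c) = 0` at every vertex,
UNCONDITIONALLY**.  With twists `±I` only, the inversion alone suffices: one-type `PlanarSkeletonNeg`, closed node N1
(**`TwistedNeg.criticalContinuity`**).  At the Cayley level (`CayleyTwist`): the additive chart `φ(gh) = φ g + φ h` of
`CayleySign₂`/`CayleyNeg₂` (which forces `b₁(Γ) ≥ 2`) is replaced by a COCYCLE `φ(gh) = φ g + ε(g) • φ h` for a sign character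
`ε : Γ → {±1}²` — equivalently a homomorphism `g ↦ (φ g, ε g)` to `(ℤ ⋊ ℤˣ)² = D_∞ × D_∞` — with the same unit-range / unit-step / `ν`, `κ` /
connected-cylinder conditions: **`CayleyTwist.criticalContinuity`**, unconditional.  So for the closed nodes the group-level input is a rank-two
homomorphism to `D_∞²`, and groups with FINITE abelianisation qualify: e.g. the Hantzsche–Wendt group `P2₁2₁2₁ = ⟨α, β | βα²β⁻¹ = α⁻², αβ²α⁻¹ = β⁻²⟩`
(`b₁ = 0`) w.r.t. its two screw generators, whose chart is the orbit map of a point on a `2`-fold axis (`φ(g) = 2π_{xy}(g·x₀ − x₀)`,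
`ε(g)` = the holonomy signs on `x, y`; the Cayley graph is the diamond net — memo §42, R-level; the instance is typed in a successor file).
What twisting does NOT do: create single-edge unit steps (the wall nets nbo/lon/sod/qtz stay where `GridCoverRigidity` put them) or help the
frames-only nodes (there a twisted one-base-vertex carrier is a `|ε(frames)|`-type carrier — the multi-type wall (R-6) itself).
* §1 `sgnMul ε` (the axis Klein group acting on `ℤ²`): involutivity;
* §2 `TwistedSign G` ⟶ `exists_point`, `exists_frame` (re-straightening), `steps`, `degree_le`, **`toSign`** (one type), **`criticalContinuity`**;
* §3 `TwistedNeg G` (twists `±I`, inversion only) ⟶ **`toNeg`**, **`criticalContinuity`** (N1);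
* §4 `CayleyTwist Γ S` (cocycle chart, `ν`, `κ`) ⟶ `twistedSign`, **`criticalContinuity`** (the additive row `CayleySign₂` of `CayleySkeletonConn`
  is the case `ε = 1`; the `{±1}` Cayley version — scalar `ε : Γ → ℤˣ`, `ν` only, through `TwistedNeg` — is identical in shape and omitted).
[cite: KozmaNitzan2024, §1 p. 2 (approach 1); §4 p. 16 (Lemma 8: the lattice symmetries)] [cite: BenjaminiSchramm1996, Conj. 4; §2 (Cayley graphs)]
[cite: ConwaySloane1999, Ch. 4 §6.1 (the diamond packing as two cosets)]
-/

noncomputable section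

namespace Summit.CriticalPhenomena.PercolationContinuityZ3.Theorems.Transplant

open MeasureTheory SimpleGraph Literature.Probability.LatticeModels Literature.Probability.Percolation
open scoped Classical

/-! ## §1 The axis Klein four-group `{±1}²` acting on `ℤ²` -/

/-- The diagonal sign map `y ↦ (ε₀ y₀, ε₁ y₁)` of `ℤ²`. [folklore] -/
def sgnMul (ε : Fin 2 → ℤˣ) (y : Site 2) : Site 2 := fun i => (ε i : ℤ) * y i

/-- Coordinates of `sgnMul`. [folklore] -/
@[simp] theorem sgnMul_apply (ε : Fin 2 → ℤˣ) (y : Site 2) (i : Fin 2) : sgnMul ε y i = (ε i : ℤ) * y i := rfl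

/-- `sgnMul ε` is an involution. [folklore] -/
@[simp] theorem sgnMul_sgnMul (ε : Fin 2 → ℤˣ) (y : Site 2) : sgnMul ε (sgnMul ε y) = y := by
  funext i; simp [← mul_assoc]

/-- The trivial signs act trivially. [folklore] -/
@[simp] theorem sgnMul_one (y : Site 2) : sgnMul 1 y = y := by
  funext i; simp

/-! ## §2 `TwistedSign`: one base vertex, frames acting by signed translations, `−I` and the axis flip at the base vertex -/

/-- **Twisted one-base-vertex form of the `(ℤ/2)²` interface.**  A sup-norm 1-Lipschitz chart `φ : V → ℤ²`, ONE base vertex `t₀`, every vertex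
the image of `t₀` under an automorphism acting on the chart by a SIGNED translation (`ε ∈ {±1}²`), at `t₀` the central inversion and the flip of the
second axis, the four outward unit steps at `t₀`, and connected cylinders at `t₀`.  Strictly more permissive than a one-type `PlanarSkeletonSign`
(whose frames have `ε = 1`) — and equivalent to it (`toSign`). [cite: KozmaNitzan2024, §4 p. 16 (Lemma 8: the lattice symmetries)] -/
structure TwistedSign {V : Type} (G : SimpleGraph V) [G.LocallyFinite] where
  /-- the chart `φ : V → ℤ²` -/
  φ : V → Site 2
  /-- `φ` is 1-Lipschitz in the sup-norm along edges -/
  lip : ∀ ⦃u v : V⦄, G.Adj u v → ∀ i : Fin 2, |φ u i - φ v i| ≤ 1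
  /-- the base vertex -/
  t₀ : V
  /-- TWISTED FRAMES: every vertex is the image of `t₀` under an automorphism acting on the chart by a signed translation -/
  frame : ∀ v : V, ∃ α : G ≃g G, ∃ ε : Fin 2 → ℤˣ, α t₀ = v ∧ ∀ w, φ (α w) - φ v = sgnMul ε (φ w - φ t₀)
  /-- the central inversion at `t₀` -/
  neg : ∃ α : G ≃g G, α t₀ = t₀ ∧ ∀ w, φ (α w) - φ t₀ = -(φ w - φ t₀)
  /-- the flip of the second axis at `t₀` -/
  flip : ∃ α : G ≃g G, α t₀ = t₀ ∧ ∀ w, φ (α w) - φ t₀ = flipSnd (φ w - φ t₀)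
  /-- (ι) at `t₀`: outward unit steps in the four chart directions -/
  step : ∀ (i : Fin 2) (σ : ℤˣ), ∃ v' : V, G.Adj t₀ v' ∧ φ v' = φ t₀ + Pi.single i (σ : ℤ)
  /-- (κ) at `t₀`: the induced cylinders `{w | φ w − φ t₀ ∈ Λ_ℓ}`, `ℓ ≥ 1`, are connected -/
  cyl_connected : ∀ ℓ : ℕ, 1 ≤ ℓ → (G.induce {w | φ w - φ t₀ ∈ box 2 ℓ}).Connected

namespace TwistedSign

variable {V : Type} {G : SimpleGraph V} [G.LocallyFinite] (Φ : TwistedSign G)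

/-- **The point group at `t₀` realises every sign twist**: `I` (identity), `−I` (`neg`), `diag(1,−1)` (`flip`), `diag(−1,1)` (`neg ∘ flip`).
[cite: KozmaNitzan2024, §4 p. 16 (Lemma 8)] -/
theorem exists_point (ε : Fin 2 → ℤˣ) :
    ∃ ρ : G ≃g G, ρ Φ.t₀ = Φ.t₀ ∧ ∀ w, Φ.φ (ρ w) - Φ.φ Φ.t₀ = sgnMul ε (Φ.φ w - Φ.φ Φ.t₀) := by
  rcases Int.units_eq_one_or (ε 0) with h0 | h0 <;> rcases Int.units_eq_one_or (ε 1) with h1 | h1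
  · refine ⟨RelIso.refl _, rfl, fun w => ?_⟩
    funext i; fin_cases i <;> simp [h0, h1]
  · obtain ⟨ρ, hρ, hφ⟩ := Φ.flip
    refine ⟨ρ, hρ, fun w => ?_⟩
    rw [hφ]; funext i; fin_cases i <;> simp [flipSnd, h0, h1]
  · obtain ⟨ρ, hρ, hφρ⟩ := Φ.neg
    obtain ⟨σ, hσ, hφσ⟩ := Φ.flip
    refine ⟨σ.trans ρ, ?_, fun w => ?_⟩
    · show ρ (σ Φ.t₀) = Φ.t₀; rw [hσ, hρ]
    · show Φ.φ (ρ (σ w)) - Φ.φ Φ.t₀ = _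
      rw [hφρ, hφσ]; funext i; fin_cases i <;> simp [flipSnd, h0, h1]
  · obtain ⟨ρ, hρ, hφ⟩ := Φ.neg
    refine ⟨ρ, hρ, fun w => ?_⟩
    rw [hφ]; funext i; fin_cases i <;> simp [h0, h1]

/-- **Re-straightening: every vertex has a TRANSLATING frame from `t₀`** (twisted frame ∘ matching point symmetry).
[cite: KozmaNitzan2024, §4 p. 16 (Lemma 8)] -/
theorem exists_frame (v : V) : ∃ α : G ≃g G, α Φ.t₀ = v ∧ ∀ w, Φ.φ (α w) = Φ.φ w + (Φ.φ v - Φ.φ Φ.t₀) := by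
  obtain ⟨α, ε, hαt, hφ⟩ := Φ.frame v
  obtain ⟨ρ, hρt, hφρ⟩ := Φ.exists_point ε
  refine ⟨ρ.trans α, ?_, fun w => ?_⟩
  · show α (ρ Φ.t₀) = v; rw [hρt, hαt]
  · show Φ.φ (α (ρ w)) = _
    have h := hφ (ρ w)
    rw [hφρ w, sgnMul_sgnMul, sub_eq_iff_eq_add] at h
    rw [h]; abel

/-- (ι) everywhere: the four outward unit steps at every vertex (transport from `t₀` by a translating frame). [cite: KozmaNitzan2024, §4 p. 15] -/
theorem steps (v : V) (i : Fin 2) (σ : ℤˣ) : ∃ v' : V, G.Adj v v' ∧ Φ.φ v' = Φ.φ v + Pi.single i (σ : ℤ) := by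
  obtain ⟨α, hαt, hφ⟩ := Φ.exists_frame v
  obtain ⟨u, hadj, hu⟩ := Φ.step i σ
  refine ⟨α u, ?_, ?_⟩
  · have h := α.map_rel_iff.2 hadj
    rwa [hαt] at h
  · rw [hφ u, hu]; abel

/-- (μ) every vertex has the degree of `t₀`. [folklore] -/
theorem degree_le (v : V) : G.degree v ≤ G.degree Φ.t₀ := by
  obtain ⟨α, hαt, -⟩ := Φ.exists_frame v
  rw [← hαt, Iso.degree_eq]

/-- **The ONE-TYPE `PlanarSkeletonSign` of a `TwistedSign`** (base vertex `t₀`; translating frames by re-straightening).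
[cite: KozmaNitzan2024, §4 p. 16 (Lemma 8)] -/
def toSign : PlanarSkeletonSign G where
  φ := Φ.φ
  lip := Φ.lip
  types := {Φ.t₀}
  frame := fun v => ⟨Φ.t₀, Finset.mem_singleton_self _, Φ.exists_frame v⟩
  neg := fun t ht => by
    rw [Finset.mem_singleton] at ht
    subst ht
    exact Φ.neg
  Δ := G.degree Φ.t₀
  degree_le := Φ.degree_le
  step := Φ.steps
  cyl_connected := fun t ht ℓ hℓ => by
    rw [Finset.mem_singleton] at ht
    subst ht
    exact Φ.cyl_connected ℓ hℓ
  flip := fun t ht => by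
    change t ∈ ({Φ.t₀} : Finset V) at ht
    rw [Finset.mem_singleton] at ht
    subst ht
    exact Φ.flip

/-- The base vertices of `toSign` are `{t₀}`. [folklore] -/
@[simp] theorem toSign_types : Φ.toSign.types = {Φ.t₀} := rfl

/-- **THEOREM (unconditional).  A locally finite graph carrying a `TwistedSign` — one base vertex, frames acting by SIGNED translations of the
chart, `−I` and an axis flip at the base vertex — has `θ_v(p_c) = 0` at EVERY vertex.**  (Closed D″ node; Φ2, `p_c < 1`, connectedness,
uniqueness derived.)  builds on p205010 (kernel theorem, internal audit signed; external expert review pending).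
[cite: BenjaminiSchramm1996, Conj. 4] [cite: KozmaNitzan2024, §1 p. 2 (approach 1)] -/
theorem criticalContinuity (Φ : TwistedSign G) (v : V) : theta G v (criticalProbIOf G v) = 0 :=
  PlanarSkeletonSign.criticalContinuity_skeleton_only Φ.toSign v

end TwistedSign

/-! ## §3 `TwistedNeg`: twists `±I` only, the central inversion alone (closed node N1) -/

/-- **Twisted one-base-vertex form of the `{±1}` interface**: as `TwistedSign` but every frame acts by `± (translation)` (`ε = ±I`) and only the
central inversion is given at `t₀` (no axis flip). [cite: KozmaNitzan2024, §4 p. 16 (Lemma 8)] -/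
structure TwistedNeg {V : Type} (G : SimpleGraph V) [G.LocallyFinite] where
  /-- the chart `φ : V → ℤ²` -/
  φ : V → Site 2
  /-- `φ` is 1-Lipschitz in the sup-norm along edges -/
  lip : ∀ ⦃u v : V⦄, G.Adj u v → ∀ i : Fin 2, |φ u i - φ v i| ≤ 1
  /-- the base vertex -/
  t₀ : V
  /-- TWISTED FRAMES with scalar sign: `φ (α w) − φ v = σ (φ w − φ t₀)`, `σ = ±1` -/
  frame : ∀ v : V, ∃ α : G ≃g G, ∃ σ : ℤˣ, α t₀ = v ∧ ∀ w, φ (α w) - φ v = (σ : ℤ) • (φ w - φ t₀)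
  /-- the central inversion at `t₀` -/
  neg : ∃ α : G ≃g G, α t₀ = t₀ ∧ ∀ w, φ (α w) - φ t₀ = -(φ w - φ t₀)
  /-- (ι) at `t₀` -/
  step : ∀ (i : Fin 2) (σ : ℤˣ), ∃ v' : V, G.Adj t₀ v' ∧ φ v' = φ t₀ + Pi.single i (σ : ℤ)
  /-- (κ) at `t₀` -/
  cyl_connected : ∀ ℓ : ℕ, 1 ≤ ℓ → (G.induce {w | φ w - φ t₀ ∈ box 2 ℓ}).Connected

namespace TwistedNeg

variable {V : Type} {G : SimpleGraph V} [G.LocallyFinite] (Φ : TwistedNeg G)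

/-- **Re-straightening with the inversion alone**: every vertex has a translating frame from `t₀`. [cite: KozmaNitzan2024, §4 p. 16 (Lemma 8)] -/
theorem exists_frame (v : V) : ∃ α : G ≃g G, α Φ.t₀ = v ∧ ∀ w, Φ.φ (α w) = Φ.φ w + (Φ.φ v - Φ.φ Φ.t₀) := by
  obtain ⟨α, σ, hαt, hφ⟩ := Φ.frame v
  rcases Int.units_eq_one_or σ with rfl | rfl
  · refine ⟨α, hαt, fun w => ?_⟩
    have h := hφ w
    rw [Units.val_one, one_smul, sub_eq_iff_eq_add] at h
    rw [h]; abel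
  · obtain ⟨ρ, hρt, hφρ⟩ := Φ.neg
    refine ⟨ρ.trans α, ?_, fun w => ?_⟩
    · show α (ρ Φ.t₀) = v; rw [hρt, hαt]
    · show Φ.φ (α (ρ w)) = _
      have h := hφ (ρ w)
      rw [hφρ w, Units.val_neg, Units.val_one, neg_smul, one_smul, neg_neg, sub_eq_iff_eq_add] at h
      rw [h]; abel

/-- (ι) everywhere. [cite: KozmaNitzan2024, §4 p. 15] -/
theorem steps (v : V) (i : Fin 2) (σ : ℤˣ) : ∃ v' : V, G.Adj v v' ∧ Φ.φ v' = Φ.φ v + Pi.single i (σ : ℤ) := by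
  obtain ⟨α, hαt, hφ⟩ := Φ.exists_frame v
  obtain ⟨u, hadj, hu⟩ := Φ.step i σ
  refine ⟨α u, ?_, ?_⟩
  · have h := α.map_rel_iff.2 hadj
    rwa [hαt] at h
  · rw [hφ u, hu]; abel

/-- (μ) every vertex has the degree of `t₀`. [folklore] -/
theorem degree_le (v : V) : G.degree v ≤ G.degree Φ.t₀ := by
  obtain ⟨α, hαt, -⟩ := Φ.exists_frame v
  rw [← hαt, Iso.degree_eq]

/-- **The ONE-TYPE `PlanarSkeletonNeg` of a `TwistedNeg`.** [cite: KozmaNitzan2024, §4 p. 16 (Lemma 8)] -/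
def toNeg : PlanarSkeletonNeg G where
  φ := Φ.φ
  lip := Φ.lip
  types := {Φ.t₀}
  frame := fun v => ⟨Φ.t₀, Finset.mem_singleton_self _, Φ.exists_frame v⟩
  neg := fun t ht => by
    rw [Finset.mem_singleton] at ht
    subst ht
    exact Φ.neg
  Δ := G.degree Φ.t₀
  degree_le := Φ.degree_le
  step := Φ.steps
  cyl_connected := fun t ht ℓ hℓ => by
    rw [Finset.mem_singleton] at ht
    subst ht
    exact Φ.cyl_connected ℓ hℓ

/-- **THEOREM (unconditional).  A locally finite graph carrying a `TwistedNeg` — one base vertex, frames acting by `±`(translation) on the chart,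
the central inversion at the base vertex — has `θ_v(p_c) = 0` at EVERY vertex** (closed one-type `{±1}` node N1).
builds on p205010 (kernel theorem, internal audit signed; external expert review pending). [cite: BenjaminiSchramm1996, Conj. 4] -/
theorem criticalContinuity (Φ : TwistedNeg G) (v : V) : theta G v (criticalProbIOf G v) = 0 :=
  PlanarSkeletonNeg.criticalContinuity_of_oneType Φ.toNeg (t := Φ.t₀) rfl v

end TwistedNeg

/-! ## §4 The Cayley level: COCYCLE charts `φ(gh) = φ g + ε(g) • φ h` (homomorphisms `Γ → D_∞ × D_∞`) -/

/-- **Sign-twisted Cayley datum, `(ℤ/2)²` version.**  A sign character `ε : Γ → {±1}²` and a map `φ : Γ → ℤ²` with the COCYCLE law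
`φ(gh) = φ g + ε(g) • φ h` (i.e. `g ↦ (φ g, ε g)` is a homomorphism to `(ℤ ⋊ ℤˣ)² = D_∞²`); unit range on `S`, the four unit steps at `1`,
group automorphisms `ν`, `κ` preserving `S` with `φ ∘ ν = −φ`, `φ ∘ κ = flipSnd ∘ φ`, and connected cylinders `{‖φ‖_∞ ≤ ℓ}` in `Cay(Γ; S)`.  For
`ε = 1` this is the additive datum `CayleySign₂` of `CayleySkeletonConn` (with all cylinders connected). [cite: KozmaNitzan2024, §4 p. 16 (Lemma 8)] [cite: BenjaminiSchramm1996, §2] -/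
structure CayleyTwist (Γ : Type) [Group Γ] (S : Finset Γ) where
  /-- the sign character (holonomy on the two chart axes) -/
  ε : Γ →* (Fin 2 → ℤˣ)
  /-- the chart -/
  φ : Γ → Site 2
  /-- the cocycle law -/
  twist : ∀ g h : Γ, φ (g * h) = φ g + sgnMul (ε g) (φ h)
  /-- generators have sup-norm `≤ 1` -/
  lip : ∀ s ∈ S, ∀ i : Fin 2, |φ s i| ≤ 1
  /-- the four unit steps at the identity -/
  step : ∀ (i : Fin 2) (σ : ℤˣ), ∃ g : Γ, (mulCayley (S : Set Γ)).Adj 1 g ∧ φ g = Pi.single i (σ : ℤ)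
  /-- the reversing automorphism -/
  ν : Γ ≃* Γ
  /-- `ν` preserves `S` -/
  ν_mem : ∀ s, ν s ∈ S ↔ s ∈ S
  /-- `φ ∘ ν = −φ` -/
  ν_φ : ∀ g, φ (ν g) = -φ g
  /-- the axis-flipping automorphism -/
  κ : Γ ≃* Γ
  /-- `κ` preserves `S` -/
  κ_mem : ∀ s, κ s ∈ S ↔ s ∈ S
  /-- `φ ∘ κ = flipSnd ∘ φ` -/
  κ_φ : ∀ g, φ (κ g) = flipSnd (φ g)
  /-- (κ) connected cylinders -/
  cyl_connected : ∀ ℓ : ℕ, 1 ≤ ℓ → ((mulCayley (S : Set Γ)).induce {g | φ g ∈ box 2 ℓ}).Connected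

namespace CayleyTwist

variable {Γ : Type} [Group Γ] {S : Finset Γ} (D : CayleyTwist Γ S)

/-- `φ 1 = 0`. [folklore] -/
theorem φ_one : D.φ 1 = 0 := by
  have h := D.twist 1 1
  rw [one_mul, map_one, sgnMul_one] at h
  exact add_eq_left.1 h.symm

/-- **THE TWISTED SIGN SKELETON OF A `CayleyTwist`**: base vertex `1`, left multiplications as frames twisted by `ε`, `ν`/`κ` as the point group.
[cite: KozmaNitzan2024, §4 p. 16 (Lemma 8)] [cite: BenjaminiSchramm1996, §2 (Cayley graphs)] -/
def twistedSign : TwistedSign (mulCayley (S : Set Γ)) where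
  φ := D.φ
  lip := fun u v h i => by
    -- along an edge `u ∼ u·s^{±1}` the chart moves by `ε(·) • φ(s)`, of sup-norm `≤ 1`
    rw [mulCayley_adj] at h
    obtain ⟨-, h | h⟩ := h
    · have e : D.φ v = D.φ u + sgnMul (D.ε u) (D.φ (u⁻¹ * v)) := by rw [← D.twist, mul_inv_cancel_left]
      have h1 := D.lip _ (Finset.mem_coe.1 h) i
      rw [e, Pi.add_apply, sgnMul_apply, ← sub_sub, sub_self, zero_sub, abs_neg, abs_mul]
      rcases Int.units_eq_one_or (D.ε u i) with h' | h' <;>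
        simp only [h', Units.val_one, Units.val_neg, abs_neg, abs_one, one_mul] <;> exact h1
    · have e : D.φ u = D.φ v + sgnMul (D.ε v) (D.φ (v⁻¹ * u)) := by rw [← D.twist, mul_inv_cancel_left]
      have h1 := D.lip _ (Finset.mem_coe.1 h) i
      rw [e, Pi.add_apply, sgnMul_apply, add_sub_cancel_left, abs_mul]
      rcases Int.units_eq_one_or (D.ε v i) with h' | h' <;>
        simp only [h', Units.val_one, Units.val_neg, abs_neg, abs_one, one_mul] <;> exact h1
  t₀ := 1
  frame := fun v => ⟨leftMulIso S v, D.ε v, mul_one v, fun w => by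
    show D.φ (v * w) - D.φ v = sgnMul (D.ε v) (D.φ w - D.φ 1)
    rw [D.twist, D.φ_one, sub_zero, add_sub_cancel_left]⟩
  neg := ⟨autOfMulEquiv S D.ν D.ν_mem, map_one D.ν, fun w => by
    show D.φ (D.ν w) - D.φ 1 = -(D.φ w - D.φ 1)
    rw [D.φ_one, sub_zero, sub_zero, D.ν_φ]⟩
  flip := ⟨autOfMulEquiv S D.κ D.κ_mem, map_one D.κ, fun w => by
    show D.φ (D.κ w) - D.φ 1 = flipSnd (D.φ w - D.φ 1)
    rw [D.φ_one, sub_zero, sub_zero, D.κ_φ]⟩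
  step := fun i σ => by
    obtain ⟨g, hadj, hφ⟩ := D.step i σ
    exact ⟨g, hadj, by rw [hφ, D.φ_one, zero_add]⟩
  cyl_connected := fun ℓ hℓ => by
    have e : {w : Γ | D.φ w - D.φ 1 ∈ box 2 ℓ} = {g : Γ | D.φ g ∈ box 2 ℓ} := by
      ext w; rw [Set.mem_setOf_eq, Set.mem_setOf_eq, D.φ_one, sub_zero]
    show ((mulCayley (S : Set Γ)).induce {w : Γ | D.φ w - D.φ 1 ∈ box 2 ℓ}).Connected
    rw [e]; exact D.cyl_connected ℓ hℓ

/-- **THEOREM (unconditional): `θ_g(p_c) = 0` at every vertex of `Cay(Γ; S)` for every group `Γ` and finite `S` carrying a `CayleyTwist`** — a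
rank-two cocycle chart (homomorphism `Γ → D_∞²`) of unit range with unit steps, `S`-automorphisms acting by `−I` and `diag(1,−1)`, connected
cylinders.  No additivity, so NO hypothesis on `b₁(Γ)`: groups with finite abelianisation qualify.
builds on p205010 (kernel theorem, internal audit signed; external expert review pending).
[cite: BenjaminiSchramm1996, Conj. 4; §2] [cite: KozmaNitzan2024, §1 p. 2 (approach 1)] -/
theorem criticalContinuity (D : CayleyTwist Γ S) (g : Γ) :
    theta (mulCayley (↑S : Set Γ)) g (criticalProbIOf (mulCayley (↑S : Set Γ)) g) = 0 :=
  D.twistedSign.criticalContinuity g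

end CayleyTwist

end Summit.CriticalPhenomena.PercolationContinuityZ3.Theorems.Transplant

end
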